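/-
Copyright (c) 2026 the pub-hodgecm-mathlib formalisation cell (harness21).  Prover seat hodgecm-mathlib-K2E1-p13 (g6), Track B ∕ K2-LIT, h413 = `stmt-HodgeConjecture-24833`,
R90-TF section S8 «ContSpec-n½», S8 dealer R90-CS-plan (g4), ruling J-S8-SRC (2) «(M1′) = FILE 2»: (V) OF RECORD ED. 16's BASIS-FREE `hsrc` binder — the INTEGRAL form
`(∫_N φ₀,z(w₀vg₁) dν)·H(g₁)^{z−2}·Θ(g₁) = A(z)·c(z)` — FROM the constant-term quotient identity `Θ(g₁)·(CT(Ec z)(g₁) − φ₀(g₁)H(g₁)^z)∕H(g₁)^{2−z} = A(z)·c(z)` (★ p864821's currency).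
-/
import Summits.HodgeConjecture.HodgeConjecture.Theorems.R90S8MidWitnessSrcOfCTQuotientU3        -- ★ p865165 (this seat, FILE 1): brings ★ `midWitnessEc`, `midWitnessExports_spec`, ★ (U1) `borelConstantTerm_chiPairEisenstein_cm_three_eq_add_mul`
import HarnessLib

/-!
# R90-TF · S8 «ContSpec-n½» — `R90S8MidWitnessSrc16OfCTQuotientU3`: (V) OF RECORD ED. 16's basis-free `hsrc` FROM THE CONSTANT-TERM QUOTIENT AT THE BASE POINT ((M1′), FILE 2)

Cell `hodgecm-mathlib`, crux H413 (`stmt-HodgeConjecture-24833`, lane `--supports … --as helper`), route of record `HCCMUnconditional`; R90-TF section S8, socket (V)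
`sock_S8_res_midBlock_ne_bot` (B ED. 7 :358), head ★ p865157 `resGMidBlock_ne_bot_of_record_v16` (K2E1-p15), binder `hsrc` (basis-free since ED. 16).  THEOREMS ONLY (no `def`, no
`instance`, no `notation`, no named-fact hypothesis, no `sorry`; default heartbeats); count-neutral; CLOSES NO SOCKET.

THE POINT (J-S8-SRC (2)).  ED. 16 restates `hsrc` WITHOUT the basis, in the INTEGRAL form
`∀ z, 2 < Re z → (∫_N flatSectionU φ₀ z (w₀·(v·g₁)) dν)·H(g₁)^{z−2}·Θ(g₁) = A(z)·c(z)`; the unfolding of record (★ p864821 `hsrc_of_record_at_basePoint_of_core`) speaks the CT-QUOTIENT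
`(CT(Ec z)(g₁) − φ₀(g₁)H(g₁)^z)∕H(g₁)^{2−z}` of a continuation `Ec` with `Ec z = E(φ₀,z)` on the tube.  ★ (U1) `CT(E(φ_z))(g) = φ_z(g) + (ν𝓕)⁻¹·∫_N φ_z(w₀vg) dν` ([MoeglinWaldspurger1995, II.1.7])
with `ν 𝓕 = 1` and `H^{z−2}·H^{2−z} = 1` make the two the same number, so (§1) the integral form follows from `Θ(g₁)·quotient = A·c` — for ANY `θ, A, c`, any base point, any continuation
`Ec` that is `E(φ₀,·)` on the tube (§1), in particular the NAMED `midWitnessEc` (§2).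
* §1 **`intertwiningIntegral_mul_eq_ctQuotient`** (the identity of the two currencies on the tube) and **`hsrc16_of_ctQuotient_at_basePoint`** (ED. 16's `hsrc` bytes, generic `θ A c g₁ Ec`).
* §2 **`hsrc16_of_midWitness_ctQuotient_at_basePoint`** — the same with `Ec := midWitnessEc …` (its tube identity is clause (E2) of ★ `midWitnessExports_spec`).
HONEST LABEL: HC_CM is proved only modulo the 7 printed citations (2 remaining named inputs: hLiu418 = `stmt-HodgeConjecture-24832`, h413 = `stmt-HodgeConjecture-24833`) until rung 0
closes; REL ≠ ★ ≠ BUILT; a currency bridge (letter-free), scalar sub-row or not; asserts no named fact and closes no socket; count-neutral.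

## References
* [MoeglinWaldspurger1995] C. Mœglin, J.-L. Waldspurger, *Spectral Decomposition and Eisenstein Series* (1995), II.1.7, IV.1.11.
* [Rogawski1990] J. D. Rogawski, *Automorphic Representations of Unitary Groups in Three Variables* (1990), §13.9 p. 229.
-/

set_option autoImplicit false
set_option linter.dupNamespace false  -- the mandated namespace `…HodgeConjecture.HodgeConjecture.R90.S8` (LEAD #1 L1) repeats the summit's segment

noncomputable section

open MeasureTheory Measure Filter Topology Set NumberField IsDedekindDomain
open scoped NNReal ENNReal
open Literature.NumberTheory Literature.NumberTheory.Automorphic Literature.NumberTheory.Automorphic.UnitaryGroup Literature.NumberTheory.GaloisRepresentations AdelicGroupData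
open Literature.NumberTheory.Automorphic.Arthur2013.Leaves.TECR Literature.MeasureTheory.Group
open Summit.HodgeConjecture.HodgeConjecture.Cruxes.H413.K2E1BorelEisensteinU
open Summit.HodgeConjecture.HodgeConjecture.Cruxes.H413.K2E1BLBorelSpacesU2Defs Summit.HodgeConjecture.HodgeConjecture.Cruxes.H413.K2E1BLBorelOperatorsU2Defs
open Summit.HodgeConjecture.HodgeConjecture.Cruxes.H413.K2E1CharacterEisensteinU2Defs
open Summit.HodgeConjecture.HodgeConjecture.Cruxes.H413.K2E1ChiSectionSpaceU2Defs
open Summit.HodgeConjecture.HodgeConjecture.Cruxes.H413.K2E1CharacterEisensteinU3PairDefs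
open Summit.HodgeConjecture.HodgeConjecture.Cruxes.H413.K2E1ChiSectionSpaceU3PairDefs
open Summit.HodgeConjecture.HodgeConjecture.Cruxes.H413.K2E1ChiEisensteinConstantTermCMThree (borelConstantTerm_chiPairEisenstein_cm_three_eq_add_mul)

namespace Summit.HodgeConjecture.HodgeConjecture.R90.S8

variable (L : Type) [Field L] [NumberField L] [IsCMField L]
  [MeasurableSpace (quasiSplit (↥(maximalRealSubfield L)) L (IsCMField.complexConj L) 3).Adelic] [BorelSpace (quasiSplit (↥(maximalRealSubfield L)) L (IsCMField.complexConj L) 3).Adelic]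

/-! ## §1 The two currencies agree on the tube; ED. 16's `hsrc` from the CT quotient -/

/-- **`(∫_N φ₀,z(w₀vg) dν)·H(g)^{z−2} = (CT(Ec z)(g) − φ₀(g)H(g)^z)∕H(g)^{2−z}`** for `2 < Re z`, a continuous bounded `(χ, 1)`-pair-section `φ₀`, a continuation `Ec` equal to `E(φ₀,·)` on the
tube, and a Heisenberg package with `ν 𝓕 = 1` (★ (U1); `H(g) > 0`). [cite: MoeglinWaldspurger1995, II.1.7] -/
theorem intertwiningIntegral_mul_eq_ctQuotient
    (ν : Measure ↥(adelicUnipotent (↥(maximalRealSubfield L)) L (IsCMField.complexConj L) 3)) [ν.IsHaarMeasure]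
    {𝓕 : Set ↥(adelicUnipotent (↥(maximalRealSubfield L)) L (IsCMField.complexConj L) 3)}
    (h𝓕N : IsFundamentalDomain ↥(rationalUnipotent (↥(maximalRealSubfield L)) L (IsCMField.complexConj L) 3) 𝓕 ν) (h𝓕c : IsCompact (closure 𝓕)) (h𝓕1 : ν 𝓕 = 1)
    {χ : HeckeCharacter L} {φ₀ : (quasiSplit (↥(maximalRealSubfield L)) L (IsCMField.complexConj L) 3).Adelic → ℂ}
    (hφ : IsChiSectionPair χ (1 : ↥(TorusDict.torus (IsCMField.complexConj L)) →ₜ* ℂˣ) φ₀) (hφc : Continuous φ₀) {Mφ : ℝ} (hφM : ∀ x, ‖φ₀ x‖ ≤ Mφ)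
    (Ec : ℂ → (quasiSplit (↥(maximalRealSubfield L)) L (IsCMField.complexConj L) 3).Adelic → ℂ) (hEis : ∀ z : ℂ, 2 < z.re → Ec z = eisensteinSeriesU (flatSectionU φ₀ z))
    {z : ℂ} (hz : 2 < z.re) (g : (quasiSplit (↥(maximalRealSubfield L)) L (IsCMField.complexConj L) 3).Adelic) :
    (∫ v : ↥(adelicUnipotent (↥(maximalRealSubfield L)) L (IsCMField.complexConj L) 3), flatSectionU φ₀ z ((quasiSplit (↥(maximalRealSubfield L)) L (IsCMField.complexConj L) 3).toAdelic (weylLongU ((IsCMField.complexConj L : L ≃ₐ[↥(maximalRealSubfield L)] L) : L →+* L) (rfl : (StdForm.antidiagonal 3).over L = (StdForm.antidiagonal 3).over L)) * ((v : (quasiSplit (↥(maximalRealSubfield L)) L (IsCMField.complexConj L) 3).Adelic) * g)) ∂ν) *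
        (((borelHeight g : ℝ) : ℂ) ^ (z - 2)) =
      (borelConstantTerm ν 𝓕 (Ec z) g - φ₀ g * (((borelHeight g : ℝ≥0) : ℝ) : ℂ) ^ z) / (((borelHeight g : ℝ≥0) : ℝ) : ℂ) ^ (2 - z) := by
  have h1aut : TorusDict.IsAutomorphic (IsCMField.complexConj L) (1 : ↥(TorusDict.torus (IsCMField.complexConj L)) →ₜ* ℂˣ) := fun t _ => by
    rw [ContinuousMonoidHom.coe_one, Pi.one_apply]
  have hH : (((borelHeight g : ℝ≥0) : ℝ) : ℂ) ≠ 0 := Complex.ofReal_ne_zero.2 (NNReal.coe_pos.2 (borelHeight_pos g)).ne'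
  have hpow : (((borelHeight g : ℝ≥0) : ℝ) : ℂ) ^ (2 - z) ≠ 0 := fun h => hH ((Complex.cpow_eq_zero_iff _ _).1 h).1
  rw [eq_div_iff hpow, hEis z hz, borelConstantTerm_chiPairEisenstein_cm_three_eq_add_mul L ν h𝓕N h𝓕c h1aut hφ hφc hφM hz g, flatSectionU_apply φ₀ z g,
    add_sub_cancel_left, h𝓕1, ENNReal.toReal_one, inv_one, Complex.ofReal_one, one_mul, mul_assoc, ← Complex.cpow_add _ _ hH, show z - 2 + (2 - z) = 0 by ring,
    Complex.cpow_zero, mul_one]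

/-- **(V) OF RECORD ED. 16's `hsrc` FROM THE CT QUOTIENT AT `g₁`** (generic `θ, A, c`, any base point `g₁`, any continuation `Ec` that is `E(φ₀,·)` on the tube, package with `ν 𝓕 = 1`): if
`θ·(CT(Ec z)(g₁) − φ₀(g₁)H(g₁)^z)∕H(g₁)^{2−z} = A(z)·c(z)` on `{2 < Re}` then `(∫_N φ₀,z(w₀vg₁) dν)·H(g₁)^{z−2}·θ = A(z)·c(z)` on `{2 < Re}` — ED. 16's binder bytes with `θ := Θ(g₁)`,
`A := ` the named lambda, `c := ` the partial-`L` quotient. [cite: MoeglinWaldspurger1995, II.1.7, IV.1.11] [cite: Rogawski1990, §13.9 p. 229] -/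
theorem hsrc16_of_ctQuotient_at_basePoint
    (ν : Measure ↥(adelicUnipotent (↥(maximalRealSubfield L)) L (IsCMField.complexConj L) 3)) [ν.IsHaarMeasure]
    {𝓕 : Set ↥(adelicUnipotent (↥(maximalRealSubfield L)) L (IsCMField.complexConj L) 3)}
    (h𝓕N : IsFundamentalDomain ↥(rationalUnipotent (↥(maximalRealSubfield L)) L (IsCMField.complexConj L) 3) 𝓕 ν) (h𝓕c : IsCompact (closure 𝓕)) (h𝓕1 : ν 𝓕 = 1)
    {χ : HeckeCharacter L} {φ₀ : (quasiSplit (↥(maximalRealSubfield L)) L (IsCMField.complexConj L) 3).Adelic → ℂ}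
    (hφ : IsChiSectionPair χ (1 : ↥(TorusDict.torus (IsCMField.complexConj L)) →ₜ* ℂˣ) φ₀) (hφc : Continuous φ₀) {Mφ : ℝ} (hφM : ∀ x, ‖φ₀ x‖ ≤ Mφ)
    (Ec : ℂ → (quasiSplit (↥(maximalRealSubfield L)) L (IsCMField.complexConj L) 3).Adelic → ℂ) (hEis : ∀ z : ℂ, 2 < z.re → Ec z = eisensteinSeriesU (flatSectionU φ₀ z))
    (θ : ℂ) (A c : ℂ → ℂ) (g₁ : (quasiSplit (↥(maximalRealSubfield L)) L (IsCMField.complexConj L) 3).Adelic)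
    (hct : ∀ z : ℂ, 2 < z.re → θ * ((borelConstantTerm ν 𝓕 (Ec z) g₁ - φ₀ g₁ * (((borelHeight g₁ : ℝ≥0) : ℝ) : ℂ) ^ z) / (((borelHeight g₁ : ℝ≥0) : ℝ) : ℂ) ^ (2 - z)) = A z * c z) :
    ∀ z : ℂ, 2 < z.re → (∫ v : ↥(adelicUnipotent (↥(maximalRealSubfield L)) L (IsCMField.complexConj L) 3), flatSectionU φ₀ z ((quasiSplit (↥(maximalRealSubfield L)) L (IsCMField.complexConj L) 3).toAdelic (weylLongU ((IsCMField.complexConj L : L ≃ₐ[↥(maximalRealSubfield L)] L) : L →+* L) (rfl : (StdForm.antidiagonal 3).over L = (StdForm.antidiagonal 3).over L)) * ((v : (quasiSplit (↥(maximalRealSubfield L)) L (IsCMField.complexConj L) 3).Adelic) * g₁)) ∂ν) * (((borelHeight g₁ : ℝ) : ℂ) ^ (z - 2)) *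
        θ = A z * c z := by
  intro z hz
  rw [intertwiningIntegral_mul_eq_ctQuotient L ν h𝓕N h𝓕c h𝓕1 hφ hφc hφM Ec hEis hz g₁, mul_comm]
  exact hct z hz

/-! ## §2 At the NAMED family `midWitnessEc` -/

/-- **ED. 16's `hsrc` FROM THE CT QUOTIENT OF THE NAMED FAMILY**: the same with `Ec := midWitnessEc …` (generic frame of the named exports; its tube identity is clause (E2) of ★
`midWitnessExports_spec`; `φ₀ ∈ chiSectionSpace χ K′ ω` is a `(χ, 1)`-pair-section) and a package with `ν 𝓕 = 1`. [cite: MoeglinWaldspurger1995, II.1.7, IV.1.11] [cite: BernsteinLapid2019, Thm 2.3] -/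
theorem hsrc16_of_midWitness_ctQuotient_at_basePoint
    [MeasurableSpace (arch (↥(maximalRealSubfield L)) L (IsCMField.complexConj L) 3 ((StdForm.antidiagonal 3).over L))] [BorelSpace (arch (↥(maximalRealSubfield L)) L (IsCMField.complexConj L) 3 ((StdForm.antidiagonal 3).over L))]
    [MeasurableSpace (finAdelic (↥(maximalRealSubfield L)) L (IsCMField.complexConj L) 3 ((StdForm.antidiagonal 3).over L))] [BorelSpace (finAdelic (↥(maximalRealSubfield L)) L (IsCMField.complexConj L) 3 ((StdForm.antidiagonal 3).over L))]
    (μ : Measure (quasiSplit (↥(maximalRealSubfield L)) L (IsCMField.complexConj L) 3).automorphicQuotient) [(quasiSplit (↥(maximalRealSubfield L)) L (IsCMField.complexConj L) 3).IsAutomorphicMeasure μ]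
    (νG : Measure (quasiSplit (↥(maximalRealSubfield L)) L (IsCMField.complexConj L) 3).Adelic) [νG.IsHaarMeasure] [νG.IsInvInvariant] [SFinite νG]
    (ν : Measure ↥(adelicUnipotent (↥(maximalRealSubfield L)) L (IsCMField.complexConj L) 3)) [ν.IsHaarMeasure] [ν.IsMulRightInvariant] [ν.IsInvInvariant]
    {𝓕 : Set ↥(adelicUnipotent (↥(maximalRealSubfield L)) L (IsCMField.complexConj L) 3)}
    (h𝓕N : IsFundamentalDomain ↥(rationalUnipotent (↥(maximalRealSubfield L)) L (IsCMField.complexConj L) 3) 𝓕 ν) (h𝓕c : IsCompact (closure 𝓕)) (h𝓕₀ : ν 𝓕 ≠ 0) (h𝓕1 : ν 𝓕 = 1)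
    {β : (quasiSplit (↥(maximalRealSubfield L)) L (IsCMField.complexConj L) 3).Adelic → ℝ≥0∞}
    (hβ : IsCoveringWeight ↥((arithmeticBorel (↥(maximalRealSubfield L)) L (IsCMField.complexConj L) 3).map (quasiSplit (↥(maximalRealSubfield L)) L (IsCMField.complexConj L) 3).arithmeticSubgroup.subtype) β)
    {μZ : Measure (borelQuotient (↥(maximalRealSubfield L)) L (IsCMField.complexConj L) 3)} [SFinite μZ]
    (hμZ : ∀ f : borelQuotient (↥(maximalRealSubfield L)) L (IsCMField.complexConj L) 3 → ℝ≥0∞, Measurable f → ∫⁻ z, f z ∂μZ = ∫⁻ g, β g * f (toBorelQuotient (↥(maximalRealSubfield L)) L (IsCMField.complexConj L) 3 g) ∂νG)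
    {χ : HeckeCharacter L} {K' : Subgroup (quasiSplit (↥(maximalRealSubfield L)) L (IsCMField.complexConj L) 3).Adelic} {ω : ↥K' → ℂ}
    {φ : (quasiSplit (↥(maximalRealSubfield L)) L (IsCMField.complexConj L) 3).Adelic → ℂ} (hφV : φ ∈ chiSectionSpace χ K' ω) (hφc : Continuous φ) {Mφ : ℝ} (hφM : ∀ x, ‖φ x‖ ≤ Mφ)
    (hK' : K' ≤ ((standardMaximalCompactGL 3 L).comap (adelicVal (↥(maximalRealSubfield L)) L (IsCMField.complexConj L) 3 ((StdForm.antidiagonal 3).over L)) : Subgroup (quasiSplit (↥(maximalRealSubfield L)) L (IsCMField.complexConj L) 3).Adelic))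
    (hKinf : ∀ k : arch (↥(maximalRealSubfield L)) L (IsCMField.complexConj L) 3 ((StdForm.antidiagonal 3).over L), adelicVal (↥(maximalRealSubfield L)) L (IsCMField.complexConj L) 3 ((StdForm.antidiagonal 3).over L) (archToAdelic (↥(maximalRealSubfield L)) L (IsCMField.complexConj L) 3 _ k) ∈ standardMaximalCompactGL 3 L →
      archToAdelic (↥(maximalRealSubfield L)) L (IsCMField.complexConj L) 3 _ k ∈ K')
    (U₀ : Subgroup (GL (Fin 3) (FiniteAdeleRing (𝓞 L) L))) (hU₀o : IsOpen (U₀ : Set (GL (Fin 3) (FiniteAdeleRing (𝓞 L) L)))) (hU₀c : IsCompact (U₀ : Set (GL (Fin 3) (FiniteAdeleRing (𝓞 L) L))))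
    (hU : ∀ b : finAdelic (↥(maximalRealSubfield L)) L (IsCMField.complexConj L) 3 ((StdForm.antidiagonal 3).over L), (b : GL (Fin 3) (FiniteAdeleRing (𝓞 L) L)) ∈ U₀ →
      ∃ hb : finAdelicToAdelic (↥(maximalRealSubfield L)) L (IsCMField.complexConj L) 3 ((StdForm.antidiagonal 3).over L) b ∈ K', ω ⟨_, hb⟩ = 1)
    (hVc : ∀ φ ∈ chiSectionSpace χ K' ω, Continuous φ)
    (μa : Measure (arch (↥(maximalRealSubfield L)) L (IsCMField.complexConj L) 3 ((StdForm.antidiagonal 3).over L))) [μa.IsHaarMeasure] [μa.IsMulRightInvariant]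
    (μf : Measure (finAdelic (↥(maximalRealSubfield L)) L (IsCMField.complexConj L) 3 ((StdForm.antidiagonal 3).over L))) [μf.IsHaarMeasure]
    {ι' : Type} [Fintype ι'] [DecidableEq ι'] (bV : Module.Basis ι' ℂ ↥(chiSectionSpace (reflectChar (IsCMField.complexConj L) χ) K' ω))
    (hbc : ∀ j, Continuous ((bV j : ↥(chiSectionSpace (reflectChar (IsCMField.complexConj L) χ) K' ω)) : (quasiSplit (↥(maximalRealSubfield L)) L (IsCMField.complexConj L) 3).Adelic → ℂ)) {Mb : ℝ}
    (hbM : ∀ j x, ‖((bV j : ↥(chiSectionSpace (reflectChar (IsCMField.complexConj L) χ) K' ω)) : (quasiSplit (↥(maximalRealSubfield L)) L (IsCMField.complexConj L) 3).Adelic → ℂ) x‖ ≤ Mb)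
    (h2 : Module.finrank (↥(maximalRealSubfield L)) L = 2) (hc : IsCMField.complexConj L ≠ 1) (hJ : ((StdForm.antidiagonal 3).over L).det ≠ 0)
    (ψ : ↥(TorusDict.torus (IsCMField.complexConj L)) →ₜ* ℂˣ) (hψ : TorusDict.IsAutomorphic (IsCMField.complexConj L) ψ)
    (θ : ℂ) (A c : ℂ → ℂ) (g₁ : (quasiSplit (↥(maximalRealSubfield L)) L (IsCMField.complexConj L) 3).Adelic)
    (hct : ∀ z : ℂ, 2 < z.re → θ * ((borelConstantTerm ν 𝓕 (midWitnessEc L μ νG ν h𝓕N h𝓕c h𝓕₀ hβ hμZ hφV hφc hφM hK' hKinf U₀ hU₀o hU₀c hU hVc μa μf bV hbc hbM h2 hc hJ ψ hψ z) g₁ -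
        φ g₁ * (((borelHeight g₁ : ℝ≥0) : ℝ) : ℂ) ^ z) / (((borelHeight g₁ : ℝ≥0) : ℝ) : ℂ) ^ (2 - z)) = A z * c z) :
    ∀ z : ℂ, 2 < z.re → (∫ v : ↥(adelicUnipotent (↥(maximalRealSubfield L)) L (IsCMField.complexConj L) 3), flatSectionU φ z ((quasiSplit (↥(maximalRealSubfield L)) L (IsCMField.complexConj L) 3).toAdelic (weylLongU ((IsCMField.complexConj L : L ≃ₐ[↥(maximalRealSubfield L)] L) : L →+* L) (rfl : (StdForm.antidiagonal 3).over L = (StdForm.antidiagonal 3).over L)) * ((v : (quasiSplit (↥(maximalRealSubfield L)) L (IsCMField.complexConj L) 3).Adelic) * g₁)) ∂ν) * (((borelHeight g₁ : ℝ) : ℂ) ^ (z - 2)) *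
        θ = A z * c z := by
  obtain ⟨-, -, -, -, hE2, -⟩ := midWitnessExports_spec L μ νG ν h𝓕N h𝓕c h𝓕₀ hβ hμZ hφV hφc hφM hK' hKinf U₀ hU₀o hU₀c hU hVc μa μf bV hbc hbM h2 hc hJ ψ hψ
  exact hsrc16_of_ctQuotient_at_basePoint L ν h𝓕N h𝓕c h𝓕1
    (IsChiSection.isChiSectionPair_of_trivial (fun t => by rw [ContinuousMonoidHom.coe_one, Pi.one_apply]) (isChiSection_of_mem hφV)) hφc hφM _ hE2 θ A c g₁ hct

end Summit.HodgeConjecture.HodgeConjecture.R90.S8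

end
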